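import Summits.NavierStokesRegularity.FluidComputer.ViscousConjugacy
import Literature.Analysis.FluidPDE.Tao2016AveragedNS.ReachCovariance
import Literature.Analysis.FluidPDE.Tao2016AveragedNS.PseudoOrbitTimingSharp
import HarnessLib

/-!
# Uniform viscosity is a change of clock, part 2 of 3: transport of reach certificates and
# adversaries; the uniformly damped member of Tao's §5.5

Companion of `ViscousConjugacy.lean` (cell `pub-fluidc`, blueprint seat bp1; ONE text in three files under
the topic directory's 400-line rule, same namespace `Summit.NavierStokesRegularity.FluidComputer.ViscousConjugacy`).
PLACEMENT: cell-own derived work, `Summits/NavierStokesRegularity/FluidComputer/` per the 2026-08-19 rule.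
HONEST FRAMING (verbatim): *low prior, high value-of-information experiment on Tao's machine paradigm; NOT
a claim that NS blows up.* Finite-dimensional quadratic ODEs with a UNIFORM damping `-μX` only; nothing
about the Navier–Stokes equations (the non-uniform part of a shell's dissipation is NOT treated — part 1,
"What is NOT claimed").

## Contents

* §3 TRANSPORT OF REACH CERTIFICATES through the conjugacy of part 1. `certificateDamp`: a reach
  certificate (`Literature…FluidComputer.ReachCertificate`) for a homogeneous quadratic `F` — working
  region `U` invariant under positive dilations, defect `ε_d`, cycle time `κ_μ(T)`, classes `Ain → Aout` —
  IS a reach certificate for `damped F μ` with defect `e^{-2μT}·ε_d`, cycle time `T`, classes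
  `Ain → dampOut e^{-μT} Aout` (all shrinkings `θ • q`, `θ ∈ [e^{-μT}, 1]`, `q ∈ Aout`) and tube
  `σ ↦ e^{-μσ} • Tube p (κ_μ σ)`. `isEmpty_damped_of_curve`: every inviscid ADVERSARY (an admissible curve
  from `Ain` avoiding all positive shrinkings of `Aout` up to inviscid time `≥ κ_μ(T)`) forbids every
  certificate for `damped F μ` with cycle time `T` — so the necessity theorems transport too.
* §4 THE UNIFORMLY DAMPED MEMBER `delayCircuitVisc K M ε μ := delayCircuitWith K M ε - μ•id` of
  [Tao2016AveragedNS, §5.5 (5.5)]: explicit global flow `delayFlowVisc K M ε μ t p = e^{-μt} • Φ_{κ_μ t}(p)`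
  (`hasDerivAt_delayFlowVisc`), read on the inviscid clock (`delayFlowVisc_viscTime`), energy decay
  `e^{-2μt}` (`energy_delayFlowVisc`), uniqueness (`delayFlowVisc_eq_of_hasDerivAt`, Picard–Lindelöf on
  the energy ball), and THE TIMED PORTRAIT of the exact inviscid flow of the datum (5.6) under the standing
  hypotheses of Theorem 5.3 (`delayFlowWith_delayInit_portrait`: quiet on `[0, 7/5]`, fired `(4,2)` on
  `[7/4, 2]`, in `firedSet K 6 4` from `2` on — the skeleton's `IsPseudoOrbit.transition_timed_sharp` at
  budget zero), which part 3 reads through the clock.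

Sources: [cite: Tao2016AveragedNS, §5.5 Theorem 5.3, (5.5), (5.6); Remark 6.1]; uniqueness via
[cite: HairerNorsettWanner1993, Thm. I.10.2] as packaged in Mathlib's `ODE_solution_unique_of_mem_Icc_right`;
the transport itself is elementary [folklore]. No named facts; 0 sorry.
-/

noncomputable section

namespace Summit.NavierStokesRegularity.FluidComputer

open Real Set Metric Filter Topology
open scoped NNReal Pointwise
open Literature.Analysis.FluidPDE.FluidComputer (ReachCertificate)
open Literature.Analysis.FluidPDE.Tao2016AveragedNS

namespace ViscousConjugacy

section General

variable {O : Type*} [NormedAddCommGroup O] [NormedSpace ℝ O] {F : O → O} {μ : ℝ}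

/-! ## §3. Transport of reach certificates through the conjugacy -/

variable {U : Set O} {Ain Aout : Set O}

/-- Widening the output class (bookkeeping). [folklore] -/
def certificateOutMono {εd τc : ℝ} (C : ReachCertificate F U εd τc Ain Aout) {Aout' : Set O}
    (h : Aout ⊆ Aout') : ReachCertificate F U εd τc Ain Aout' where
  Tube := C.Tube
  Tube_closed := C.Tube_closed
  Tube_zero := C.Tube_zero
  Tube_sub := C.Tube_sub
  cert p hp σT x h0 hσT hx0 hcont hU hW := by
    obtain ⟨h1, h2⟩ := C.cert p hp σT x h0 hσT hx0 hcont hU hW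
    refine ⟨h1, fun hσ => ?_⟩
    obtain ⟨σ, hσI, hA⟩ := h2 hσ
    exact ⟨σ, hσI, h hA⟩

/-- The **shrinkings** of a class: `dampOut θ₀ A = {θ • q : θ ∈ [θ₀, 1], q ∈ A}` — where a damped machine
delivers an inviscid output class. [folklore] -/
def dampOut (θ₀ : ℝ) (A : Set O) : Set O := {x | ∃ θ ∈ Icc θ₀ 1, ∃ q ∈ A, x = θ • q}

/-- A shrinking `θ • q`, `θ ∈ [θ₀, 1]`, of a point of `A` lies in `dampOut θ₀ A`. [folklore] -/
theorem smul_mem_dampOut {θ₀ θ : ℝ} {A : Set O} {q : O} (hθ : θ ∈ Icc θ₀ 1) (hq : q ∈ A) :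
    θ • q ∈ dampOut θ₀ A :=
  ⟨θ, hθ, q, hq, rfl⟩

/-- `A ⊆ dampOut θ₀ A` for `θ₀ ≤ 1`. [folklore] -/
theorem subset_dampOut {θ₀ : ℝ} (hθ : θ₀ ≤ 1) (A : Set O) : A ⊆ dampOut θ₀ A :=
  fun q hq => ⟨1, ⟨hθ, le_rfl⟩, q, hq, (one_smul ℝ q).symm⟩

/-- **TRANSPORT OF REACH CERTIFICATES (sufficiency).** Let `F (c • X) = c² • F X`, `μ > 0`, and let the
working region `U` be invariant under positive dilations. A reach certificate for `F` with defect `ε_d`,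
cycle time `κ_μ(T)` and classes `Ain → Aout` IS a reach certificate for the uniformly damped field
`damped F μ` with defect `e^{-2μT}·ε_d`, cycle time `T`, classes `Ain → dampOut e^{-μT} Aout`, and tube
`σ ↦ e^{-μσ} • Tube p (κ_μ σ)`: a viscous admissible curve `y` is read undamped,
`x(s) = (1 - μs)⁻¹ • y(T_μ s)`, an inviscid admissible curve with defect `≤ (1 - μs)⁻² e^{-2μT} ε_d ≤ ε_d`
(`hasDerivWithinAt_undamp`), to which the given certificate applies; its passage through `q ∈ Aout` at
inviscid time `s` is the passage of `y` through `(1 - μs) • q`, `1 - μs ∈ [e^{-μT}, 1]`.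
[folklore; the rescaling of [Tao2016AveragedNS, Remark 6.1] made time-dependent] -/
def certificateDamp {εd T : ℝ} (hF : ∀ (c : ℝ) (X : O), F (c • X) = c ^ 2 • F X)
    (hU : ∀ c : ℝ, 0 < c → c • U ⊆ U) (hμ : 0 < μ)
    (C : ReachCertificate F U εd (viscClock μ T) Ain Aout) :
    ReachCertificate (damped F μ) U (exp (-(μ * T)) ^ 2 * εd) T Ain
      (dampOut (exp (-(μ * T))) Aout) where
  Tube p σ := exp (-(μ * σ)) • C.Tube p (viscClock μ σ)
  Tube_closed p hp := by
    have h1 : Continuous (viscClock μ) := continuous_viscClock μ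
    have hφ : Continuous fun z : ℝ × O => ((viscClock μ z.1, exp (μ * z.1) • z.2) : ℝ × O) := by
      fun_prop
    have hS := (C.Tube_closed p hp).preimage hφ
    convert hS using 1
    ext z
    simp only [mem_setOf_eq, mem_preimage, mem_Icc]
    rw [Set.mem_smul_set_iff_inv_smul_mem₀ (exp_pos _).ne', Real.exp_neg, inv_inv]
    constructor
    · rintro ⟨⟨h0, hT⟩, h2⟩
      exact ⟨⟨viscClock_nonneg hμ h0, (viscClock_le_viscClock_iff hμ).2 hT⟩, h2⟩
    · rintro ⟨⟨h0, hT⟩, h2⟩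
      refine ⟨⟨?_, (viscClock_le_viscClock_iff hμ).1 hT⟩, h2⟩
      rw [← viscClock_zero μ] at h0
      exact (viscClock_le_viscClock_iff hμ).1 h0
  Tube_zero p hp := by
    rw [mul_zero, neg_zero, exp_zero, one_smul, viscClock_zero]
    exact C.Tube_zero p hp
  Tube_sub p hp σ hσ :=
    (Set.smul_set_mono (C.Tube_sub p hp (viscClock μ σ)
      ⟨viscClock_nonneg hμ hσ.1, (viscClock_le_viscClock_iff hμ).2 hσ.2⟩)).trans (hU _ (exp_pos _))
  cert p hp σT y h0 hσT hy0 hcont hyU hW := by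
    have hμ0 : μ ≠ 0 := hμ.ne'
    obtain ⟨S, hSdef⟩ : ∃ S : ℝ, S = viscClock μ σT := ⟨_, rfl⟩
    have hS0 : 0 ≤ S := by rw [hSdef]; exact viscClock_nonneg hμ h0
    have hST : S ≤ viscClock μ T := by rw [hSdef]; exact (viscClock_le_viscClock_iff hμ).2 hσT
    have hS1 : μ * S < 1 := by rw [hSdef]; exact mul_viscClock_lt_one hμ0 σT
    have hpos : ∀ r, r ≤ S → 0 < 1 - μ * r := fun r hr => by
      have := mul_le_mul_of_nonneg_left hr hμ.le
      linarith
    have hlt1 : ∀ r, r ≤ S → μ * r < 1 := fun r hr => by linarith [hpos r hr]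
    have hge : ∀ r, r ≤ S → exp (-(μ * T)) ≤ 1 - μ * r := fun r hr => by
      have h1 := one_sub_mul_viscClock hμ0 T
      have h2 := mul_le_mul_of_nonneg_left (hr.trans hST) hμ.le
      linarith
    -- the viscous time of inviscid time `r ∈ [0, S]` lies in `[0, σT]`
    have htS : viscTime μ S = σT := by rw [hSdef, viscTime_viscClock hμ0]
    have ht0 : ∀ r, 0 ≤ r → r ≤ S → viscTime μ r ∈ Icc 0 σT := fun r h0r hrS =>
      ⟨viscTime_nonneg hμ h0r (hlt1 r hrS), by
        rw [← htS]; exact viscTime_le_viscTime hμ hrS hS1⟩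
    have htlt : ∀ r, 0 ≤ r → r < S → viscTime μ r ∈ Ico 0 σT := fun r h0r hrS =>
      ⟨viscTime_nonneg hμ h0r (hlt1 r hrS.le), by
        rw [← htS]; exact viscTime_lt_viscTime hμ hrS hS1⟩
    -- the undamped curve, in inviscid time
    set x : ℝ → O := fun r => (1 - μ * r)⁻¹ • y (viscTime μ r) with hxdef
    have hx0 : x 0 = p := by
      simp only [hxdef, mul_zero, sub_zero, inv_one, one_smul, viscTime_zero, hy0]
    have hcx : ContinuousOn x (Icc 0 S) := by
      have hct : ContinuousOn (viscTime μ) (Icc 0 S) := fun r hr =>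
        (hasDerivAt_viscTime hμ0 (hlt1 r hr.2)).continuousAt.continuousWithinAt
      have hmaps : MapsTo (viscTime μ) (Icc 0 S) (Icc 0 σT) := fun r hr => ht0 r hr.1 hr.2
      have hci : ContinuousOn (fun r : ℝ => (1 - μ * r)⁻¹) (Icc 0 S) :=
        ContinuousOn.inv₀ (by fun_prop) fun r hr => (hpos r hr.2).ne'
      exact hci.smul (hcont.comp hct hmaps)
    have hxU : ∀ r ∈ Ico 0 S, x r ∈ U := fun r hr =>
      hU _ (inv_pos.2 (hpos r hr.2.le)) (Set.smul_mem_smul_set (hyU _ (htlt r hr.1 hr.2)))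
    have hxW : ∀ r ∈ Ico 0 S, ∃ W : O, HasDerivWithinAt x W (Ici r) r ∧ ‖W - F (x r)‖ ≤ εd := by
      intro r hr
      obtain ⟨W, hW1, hW2⟩ := hW (viscTime μ r) (htlt r hr.1 hr.2)
      have hq := hpos r hr.2.le
      refine ⟨_, hasDerivWithinAt_undamp hμ (hlt1 r hr.2.le) hW1, ?_⟩
      have e : (1 - μ * r)⁻¹ ^ 2 • (W + μ • y (viscTime μ r)) - F (x r) =
          (1 - μ * r)⁻¹ ^ 2 • (W - damped F μ (y (viscTime μ r))) := by
        simp only [hxdef, damped_apply]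
        rw [hF]
        module
      rw [e, norm_smul, norm_pow, norm_inv, Real.norm_eq_abs, abs_of_pos hq]
      have hεd : 0 ≤ εd := by
        by_contra hc
        have : exp (-(μ * T)) ^ 2 * εd < 0 := mul_neg_of_pos_of_neg (by positivity) (not_le.1 hc)
        linarith [(norm_nonneg _).trans hW2]
      have hk : (1 - μ * r)⁻¹ ^ 2 * exp (-(μ * T)) ^ 2 ≤ 1 := by
        rw [← mul_pow]
        refine pow_le_one₀ (mul_nonneg (inv_pos.2 hq).le (exp_pos _).le) ?_
        rw [inv_mul_le_iff₀ hq, mul_one]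
        exact hge r hr.2.le
      calc (1 - μ * r)⁻¹ ^ 2 * ‖W - damped F μ (y (viscTime μ r))‖
          ≤ (1 - μ * r)⁻¹ ^ 2 * (exp (-(μ * T)) ^ 2 * εd) :=
            mul_le_mul_of_nonneg_left hW2 (sq_nonneg _)
        _ = (1 - μ * r)⁻¹ ^ 2 * exp (-(μ * T)) ^ 2 * εd := by ring
        _ ≤ 1 * εd := mul_le_mul_of_nonneg_right hk hεd
        _ = εd := one_mul εd
    obtain ⟨h1, h2⟩ := C.cert p hp S x hS0 hST hx0 hcx hxU hxW
    refine ⟨?_, fun hσ => ?_⟩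
    · have hyx : y σT = exp (-(μ * σT)) • x S := by
        simp only [hxdef]
        rw [htS, hSdef, one_sub_mul_viscClock hμ0, smul_smul, mul_inv_cancel₀ (exp_pos _).ne',
          one_smul]
      rw [hyx, ← hSdef]
      exact Set.smul_mem_smul_set h1
    · have hSτ : S = viscClock μ T := by rw [hSdef, hσ]
      obtain ⟨s, hs, hsA⟩ := h2 hSτ
      have hsS : s ≤ S := by rw [hSτ]; exact hs.2
      have hq := hpos s hsS
      refine ⟨viscTime μ s, by rw [← hσ]; exact ht0 s hs.1 hsS, ?_⟩
      have hyσ : y (viscTime μ s) = (1 - μ * s) • x s := by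
        simp only [hxdef]
        rw [smul_smul, mul_inv_cancel₀ hq.ne', one_smul]
      rw [hyσ]
      refine ⟨1 - μ * s, ⟨hge s hsS, ?_⟩, x s, hsA, rfl⟩
      have : 0 ≤ μ * s := mul_nonneg hμ.le hs.1
      linarith

/-- The tube of the damped certificate. [folklore] -/
theorem certificateDamp_tube {εd T : ℝ} (hF : ∀ (c : ℝ) (X : O), F (c • X) = c ^ 2 • F X)
    (hU : ∀ c : ℝ, 0 < c → c • U ⊆ U) (hμ : 0 < μ)
    (C : ReachCertificate F U εd (viscClock μ T) Ain Aout) (p : O) (σ : ℝ) :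
    (certificateDamp hF hU hμ C).Tube p σ = exp (-(μ * σ)) • C.Tube p (viscClock μ σ) :=
  rfl

/-- **TRANSPORT OF ADVERSARIES (necessity).** `F` homogeneous quadratic, `μ > 0`, `U` open. If an
inviscid admissible curve `x` from `p ∈ Ain` with defect `≤ ε_d` on `[0, S']`, `S' ≥ κ_μ(T)`, has NO positive
shrinking `θ • x s` (`θ ∈ (0,1]`, `s ∈ [0,S']`) in `Aout`, then there is no reach certificate for
`damped F μ` over `U` with defect `ε_d`, cycle time `T`, classes `Ain → Aout`: the damped curve
`t ↦ e^{-μt} • x(κ_μ t)` is admissible with defect `≤ e^{-2μt} ε_d ≤ ε_d` (`hasDerivWithinAt_damp`) and the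
REACH property would put some `e^{-μσ} • x(κ_μ σ)` into `Aout`. [folklore] -/
theorem isEmpty_damped_of_curve (hF : ∀ (c : ℝ) (X : O), F (c • X) = c ^ 2 • F X) (hμ : 0 < μ)
    (hUo : IsOpen U) {εd T S' : ℝ} (hT : 0 ≤ T) (hS : viscClock μ T ≤ S') {p : O} (hp : p ∈ Ain)
    {x : ℝ → O} (hx0 : x 0 = p) (hcont : ContinuousOn x (Icc 0 S'))
    (hW : ∀ s ∈ Ico 0 S', ∃ W : O, HasDerivWithinAt x W (Ici s) s ∧ ‖W - F (x s)‖ ≤ εd)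
    (havoid : ∀ s ∈ Icc 0 S', ∀ θ : ℝ, 0 < θ → θ ≤ 1 → θ • x s ∉ Aout) :
    IsEmpty (ReachCertificate (damped F μ) U εd T Ain Aout) := by
  refine ⟨fun C => ?_⟩
  set y : ℝ → O := fun t => exp (-(μ * t)) • x (viscClock μ t) with hydef
  have hy0 : y 0 = p := by simp [hydef, hx0]
  have hmaps : MapsTo (viscClock μ) (Icc 0 T) (Icc 0 S') := fun t ht =>
    ⟨viscClock_nonneg hμ ht.1, ((viscClock_le_viscClock_iff hμ).2 ht.2).trans hS⟩
  have hcy : ContinuousOn y (Icc 0 T) :=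
    (by fun_prop : Continuous fun t : ℝ => exp (-(μ * t))).continuousOn.smul
      (hcont.comp (continuous_viscClock μ).continuousOn hmaps)
  have hyW : ∀ t ∈ Ico 0 T, ∃ W : O, HasDerivWithinAt y W (Ici t) t ∧
      ‖W - damped F μ (y t)‖ ≤ εd := by
    intro t ht
    have hct : viscClock μ t ∈ Ico 0 S' :=
      ⟨viscClock_nonneg hμ ht.1, ((viscClock_lt_viscClock_iff hμ).2 ht.2).trans_le hS⟩
    obtain ⟨W, hW1, hW2⟩ := hW _ hct
    refine ⟨_, hasDerivWithinAt_damp hF hμ hW1, ?_⟩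
    simp only [hydef]
    rw [add_sub_cancel_left, norm_smul, norm_pow, Real.norm_eq_abs, abs_of_pos (exp_pos _)]
    have he : exp (-(μ * t)) ^ 2 ≤ 1 := by
      refine pow_le_one₀ (exp_pos _).le ?_
      rw [exp_le_one_iff]
      have := mul_nonneg hμ.le ht.1
      linarith
    have hεd : 0 ≤ εd := (norm_nonneg _).trans hW2
    calc exp (-(μ * t)) ^ 2 * ‖W - F (x (viscClock μ t))‖ ≤ 1 * εd :=
          mul_le_mul he hW2 (norm_nonneg _) zero_le_one
      _ = εd := one_mul εd
  obtain ⟨σ, hσ, hA⟩ := C.reach hUo hp hT hy0 hcy hyW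
  have hle : exp (-(μ * σ)) ≤ 1 := by
    rw [exp_le_one_iff]
    have := mul_nonneg hμ.le hσ.1
    linarith
  exact havoid (viscClock μ σ) (hmaps hσ) (exp (-(μ * σ))) (exp_pos _) hle hA

end General

/-! ## §4. Tao's gate under uniform viscosity -/

variable {K M ε μ : ℝ}

/-- **The uniformly damped member**: `delayCircuitVisc K M ε μ X = delayCircuitWith K M ε X - μ • X` — the
five-mode circuit (5.5) of [Tao2016AveragedNS, §5.5] with every mode damped at the same rate `μ` (the
uniform part of a dissipation `νλ_n²` on one shell, in rescaled time).
[cite: Tao2016AveragedNS, §5.5 (5.5); §6] -/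
abbrev delayCircuitVisc (K M ε μ : ℝ) : (Fin 5 → ℝ) → (Fin 5 → ℝ) :=
  damped (delayCircuitWith K M ε) μ

/-- `delayCircuitVisc K M ε μ X = delayCircuitWith K M ε X - μ • X`. [cite: Tao2016AveragedNS, §5.5 (5.5)] -/
theorem delayCircuitVisc_apply (K M ε μ : ℝ) (X : Fin 5 → ℝ) :
    delayCircuitVisc K M ε μ X = delayCircuitWith K M ε X - μ • X :=
  rfl

/-- `μ = 0` is the member itself. [cite: Tao2016AveragedNS, §5.5 (5.5)] -/
theorem delayCircuitVisc_zero (K M ε : ℝ) : delayCircuitVisc K M ε 0 = delayCircuitWith K M ε :=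
  damped_zero _

/-- **The explicit viscous flow**: `delayFlowVisc K M ε μ t p = e^{-μt} • Φ_{κ_μ(t)}(p)` with `Φ` the
inviscid flow `delayFlowWith`. [folklore] -/
def delayFlowVisc (K M ε μ t : ℝ) (p : Fin 5 → ℝ) : Fin 5 → ℝ :=
  exp (-(μ * t)) • delayFlowWith K M ε (viscClock μ t) p

/-- The viscous flow starts at its datum. [folklore] -/
theorem delayFlowVisc_zero (K M ε μ : ℝ) (p : Fin 5 → ℝ) : delayFlowVisc K M ε μ 0 p = p := by
  simp [delayFlowVisc, delayFlowWith_zero]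

/-- The viscous flow solves `Ẋ = delayCircuitWith X - μX` (`μ ≠ 0`). [folklore] -/
theorem hasDerivAt_delayFlowVisc (hμ : μ ≠ 0) (p : Fin 5 → ℝ) (t : ℝ) :
    HasDerivAt (fun s => delayFlowVisc K M ε μ s p)
      (delayCircuitVisc K M ε μ (delayFlowVisc K M ε μ t p)) t :=
  hasDerivAt_damp_of_solution (delayCircuitWith_smul K M ε) hμ (hasDerivAt_delayFlowWith K M ε p) t

/-- Read on the inviscid clock: `X(T_μ τ) = (1 - μτ) • Φ_τ(p)` for `μτ < 1`. [folklore] -/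
theorem delayFlowVisc_viscTime (hμ : μ ≠ 0) {τ : ℝ} (h : μ * τ < 1) (p : Fin 5 → ℝ) :
    delayFlowVisc K M ε μ (viscTime μ τ) p = (1 - μ * τ) • delayFlowWith K M ε τ p := by
  rw [delayFlowVisc, exp_neg_mul_viscTime hμ h, viscClock_viscTime hμ h]

/-- Undoing the shrinking: `e^{μt} • X(t) = Φ_{κ_μ t}(p)`. [folklore] -/
theorem exp_smul_delayFlowVisc (μ t : ℝ) (p : Fin 5 → ℝ) :
    exp (μ * t) • delayFlowVisc K M ε μ t p = delayFlowWith K M ε (viscClock μ t) p := by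
  rw [delayFlowVisc, smul_smul, ← Real.exp_add, add_neg_cancel, exp_zero, one_smul]

/-- Energy decay: `energy (X t) = e^{-2μt} energy p` (the member is cancelling). [folklore] -/
theorem energy_delayFlowVisc (μ t : ℝ) (p : Fin 5 → ℝ) :
    energy (delayFlowVisc K M ε μ t p) = exp (-(2 * μ * t)) * energy p := by
  rw [delayFlowVisc, energy_smul', energy_delayFlowWith, sq, ← Real.exp_add]
  congr 2
  ring

/-- `0 ≤ energy p`. [folklore] -/
theorem energy_nonneg' (p : Fin 5 → ℝ) : 0 ≤ energy p := by
  simp only [energy]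
  positivity

/-- **Uniqueness**: every solution of `Ẋ = delayCircuitWith X - μX` on `[0, ∞)` (`μ > 0`) is the explicit
viscous flow of its datum (Picard–Lindelöf / Gronwall in Mathlib, on the energy ball). [folklore] -/
theorem delayFlowVisc_eq_of_hasDerivAt (hμ : 0 < μ) {X : ℝ → Fin 5 → ℝ} {p : Fin 5 → ℝ}
    (hX : ∀ t, 0 ≤ t → HasDerivAt X (delayCircuitVisc K M ε μ (X t)) t) (h0 : X 0 = p)
    {t : ℝ} (ht : 0 ≤ t) : X t = delayFlowVisc K M ε μ t p := by
  set R : ℝ≥0 := ⟨Real.sqrt (energy p), Real.sqrt_nonneg _⟩ with hR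
  have hv : ∀ s ∈ Ico 0 t, LipschitzOnWith (delayLipschitzWith K M ε R + ‖μ‖₊)
      (delayCircuitVisc K M ε μ) (closedBall (0 : Fin 5 → ℝ) R) := fun s _ =>
    lipschitzOnWith_damped (lipschitzOnWith_delayCircuitWith K M ε R) μ
  have hdec : ∀ s, 0 ≤ s → exp (-(2 * μ * s)) ≤ 1 := fun s hs => by
    rw [exp_le_one_iff]
    have := mul_nonneg hμ.le hs
    linarith
  have hbX : ∀ s ∈ Ico 0 t, X s ∈ closedBall (0 : Fin 5 → ℝ) R := fun s hs => by
    rw [mem_closedBall, dist_zero_right]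
    refine (norm_le_sqrt_energy (X s)).trans (Real.sqrt_le_sqrt ?_)
    rw [energy_eq_of_damped (isCancelling_delayCircuitWith K M ε) hX hs.1, h0]
    have := hdec s hs.1
    have h2 := energy_nonneg' p
    nlinarith
  have hbΦ : ∀ s ∈ Ico 0 t, delayFlowVisc K M ε μ s p ∈ closedBall (0 : Fin 5 → ℝ) R := fun s hs => by
    rw [mem_closedBall, dist_zero_right]
    refine (norm_le_sqrt_energy _).trans (Real.sqrt_le_sqrt ?_)
    rw [energy_delayFlowVisc]
    have := hdec s hs.1
    have h2 := energy_nonneg' p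
    nlinarith
  have hΦ := hasDerivAt_delayFlowVisc (K := K) (M := M) (ε := ε) hμ.ne' p
  exact ODE_solution_unique_of_mem_Icc_right hv
    (fun s hs => (hX s hs.1).continuousAt.continuousWithinAt)
    (fun s hs => (hX s hs.1).hasDerivWithinAt) hbX
    (fun s _ => (hΦ s).continuousAt.continuousWithinAt)
    (fun s _ => (hΦ s).hasDerivWithinAt) hbΦ
    (by rw [h0, delayFlowVisc_zero]) (right_mem_Icc.2 ht)

section Standing

variable (hK : 2 * 20 ^ 42 * (Nat.factorial 42 : ℝ) + 16 ≤ K)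
  (hML : 3000 * Real.log K ≤ M) (hMK : M ≤ K ^ 10) (hε : 0 < ε)
  (hεle : ε ≤ exp (-(10 * M)) / K ^ 100)
include hK hML hMK hε hεle

/-- **The exact inviscid flow of the datum (5.6), timed**: QUIET on `[0, 7/5]` (`|ã|, |d| ≤ 4K⁻¹⁰`,
`|c| ≤ ε²K⁻¹⁰`, `|b| ≤ 2ε`, `a² ≥ 0.999`), FIRED `(4,2)` on `[7/4, 2]` and in `firedSet K 6 4` at every time
`τ ≥ 2` — [Tao2016AveragedNS, Theorem 5.3] with the transition window `[7/5, 7/4]` of the skeleton's sharp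
timing theorem (`IsPseudoOrbit.transition_timed_sharp` at budget zero).
[cite: Tao2016AveragedNS, §5.5 Theorem 5.3] -/
theorem delayFlowWith_delayInit_portrait :
    QuietOn K ε (fun τ => delayFlowWith K M ε τ delayInit) (Icc 0 (7 / 5)) ∧
    FiredOn K (fun τ => delayFlowWith K M ε τ delayInit) (Icc (7 / 4) 2) 4 2 ∧
    ∀ τ : ℝ, 2 ≤ τ → delayFlowWith K M ε τ delayInit ∈ firedSet K 6 4 := by
  obtain ⟨-, hM4, -, -, -, -⟩ := negKick_params hK hML hMK hε hεle
  have hsq0 : 0 < Real.sqrt M := Real.sqrt_pos.2 (by linarith)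
  have hB : ∀ T : ℝ, (0 : ℝ) + 0 * T < 3133 / 2500 * (ε ^ 2 * exp (-M)) / Real.sqrt M := by
    intro T
    rw [zero_mul, add_zero]
    positivity
  have hE1 : ∀ τ, energy (delayFlowWith K M ε τ delayInit) = 1 := fun τ =>
    delayCircuitWith_energy_init (hasDerivAt_delayFlowWith K M ε delayInit)
      (delayFlowWith_zero K M ε delayInit) τ
  have hPO : ∀ T : ℝ, IsPseudoOrbit (delayCircuitWith K M ε) 0 2 T
      (fun τ => delayFlowWith K M ε τ delayInit) := fun T =>
    IsPseudoOrbit.of_hasDerivAt (hasDerivAt_delayFlowWith K M ε delayInit) fun τ _ => by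
      have h := norm_le_sqrt_energy (delayFlowWith K M ε τ delayInit)
      rw [hE1, Real.sqrt_one] at h
      exact h.trans (by norm_num)
  have h0 : ‖(fun τ => delayFlowWith K M ε τ delayInit) 0 - delayInit‖ ≤ 0 := by
    simp [delayFlowWith_zero]
  have key := fun (T : ℝ) (hT : 2 ≤ T) =>
    (hPO T).transition_timed_sharp hK hML hMK hε hεle hT h0 (hB T)
  obtain ⟨hQ, hF1, -⟩ := key 2 le_rfl
  refine ⟨hQ, hF1, fun τ hτ => ?_⟩
  obtain ⟨-, -, hF2⟩ := key τ hτ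
  exact hF2 τ ⟨hτ, le_rfl⟩

end Standing

end ViscousConjugacy

end Summit.NavierStokesRegularity.FluidComputer
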